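import Summits.AnomalousDissipation.AnomalousDissipation.Theorems.SolenoidalFractalHomogenisationLagrangianStepFrameReadingDefs
import Summits.AnomalousDissipation.AnomalousDissipation.Theorems.SolenoidalFractalHomogenisationLagrangianStepZ7GlueDefs
import Summits.AnomalousDissipation.AnomalousDissipation.Theorems.SolenoidalFractalHomogenisationLagrangianStepFrameDefs
import HarnessLib

/-!
# K1L_D (stmt-AnomalousDissipation-27980), `stub_Z7_alphaBeta` α-provider, (T4) of memo L13: the reading-map algebra and the ASSEMBLY of
# `Z7Glue.FrameConjugacyAt` from a modulation datum and the two distorted propagators (helper; `--supports … --as helper`; lead-k1l-onelevel-p1 g5)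

§1 the reading maps of `…FrameReadingDefs` (p697294) are isometries that are the identity at the reset and invert each other
(`frameRead_zero`, `frameReadInv_zero`, `frameRead_frameReadInv`, `norm_frameRead`, `inner_frameRead`, `adjoint_frameRead_apply`), and the
conjugate family on the whole piece reads `conjProp U 0 (a(t−s)) = frameRead (a(t−s)) ∘ U s t` (`conjProp_zero_eq`).
§2 **`frameConjugacyAt_of`** — (T4): given `IsModulation θ (a(t−s)) (ϱ·N m) (frameG-curve)` with `θ ≤ Cα·θ(m+1)` and the two facts
`IsDistortedPropagator … (conjProp … Um1)` (cell member) / `… (conjProp … Um)` (coarse member) — targets (T2)/(T3) of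
`Cruxes/…/Lines/onelevel_L13_frame.lean` —, the piece satisfies `Z7Glue.FrameConjugacyAt W M hM c Φ Cα ϱ E m S Um1 Um s t` with `ι = id`,
`ι' = frameRead (a(t−s))`: the conjugacy and the two loss identities are pure isometry algebra (they hold for all data, not only solenoidal).
NOT a proof of (T1)–(T3), of `stub_Z7_alphaBeta`, of the crux, or of AD; rung F-D1.A0.
-/

set_option linter.dupNamespace false  -- the summit-side namespace `Summit.AnomalousDissipation.AnomalousDissipation.…` repeats a component by design (D-0017)

noncomputable section

namespace Summit.AnomalousDissipation.AnomalousDissipation.Theorems.SolenoidalFractalHomogenisation.LagrangianStep.FrameConj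

open Literature.Analysis Literature.Analysis.FluidPDE Literature.Analysis.FunctionSpaces
open MeasureTheory Set
open scoped InnerProductSpace
open Literature.Analysis.FluidPDE.LatticeShear (LagrangianLatticeCarrier LatticeWord)
open Summit.AnomalousDissipation.AnomalousDissipation.Theorems.SolenoidalFractalHomogenisation.LagrangianStep.CellClauseMod
open Summit.AnomalousDissipation.AnomalousDissipation.Theorems.SolenoidalFractalHomogenisation.LagrangianStep.Z7Glue

variable {k : ℕ}

/-! ## §1 Reading-map algebra -/

/-- The reading map is composition with the window flow, almost everywhere. -/
theorem frameRead_coeFn (E : LagrangianLatticeCarrier k) (hR : E.LevelRegular) (m : ℕ) (s σ : ℝ) (u : V2) :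
    (⇑(frameRead E hR m s σ u) : VF) =ᵐ[volume] fun y => (u : VF) (E.X m (s + σ / E.a (m + 1)) s y) :=
  Lp.coeFn_compMeasurePreserving u _

/-- The inverse reading map is composition with the inverse flow, almost everywhere. -/
theorem frameReadInv_coeFn (E : LagrangianLatticeCarrier k) (hR : E.LevelRegular) (m : ℕ) (s σ : ℝ) (v : V2) :
    (⇑(frameReadInv E hR m s σ v) : VF) =ᵐ[volume] fun y => (v : VF) (E.X m s (s + σ / E.a (m + 1)) y) :=
  Lp.coeFn_compMeasurePreserving v _

/-- The reading map is an isometry. -/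
theorem norm_frameRead (E : LagrangianLatticeCarrier k) (hR : E.LevelRegular) (m : ℕ) (s σ : ℝ) (u : V2) :
    ‖frameRead E hR m s σ u‖ = ‖u‖ :=
  (Lp.compMeasurePreservingₗᵢ ℝ (E.X m (s + σ / E.a (m + 1)) s) (hR.measurePreserving_X m (s + σ / E.a (m + 1)) s)).norm_map u

/-- The reading map preserves inner products. -/
theorem inner_frameRead (E : LagrangianLatticeCarrier k) (hR : E.LevelRegular) (m : ℕ) (s σ : ℝ) (u v : V2) :
    ⟪frameRead E hR m s σ u, frameRead E hR m s σ v⟫_ℝ = ⟪u, v⟫_ℝ :=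
  (Lp.compMeasurePreservingₗᵢ ℝ (E.X m (s + σ / E.a (m + 1)) s) (hR.measurePreserving_X m (s + σ / E.a (m + 1)) s)).inner_map_map u v

/-- At the reset the reading map is the identity (`X m s s = id`). -/
theorem frameRead_zero (E : LagrangianLatticeCarrier k) (hR : E.LevelRegular) (m : ℕ) (s : ℝ) (u : V2) : frameRead E hR m s 0 u = u := by
  refine Lp.ext ((frameRead_coeFn E hR m s 0 u).trans (Filter.Eventually.of_forall fun y => ?_))
  simp [hR.X_self m s]

/-- At the reset the inverse reading map is the identity. -/
theorem frameReadInv_zero (E : LagrangianLatticeCarrier k) (hR : E.LevelRegular) (m : ℕ) (s : ℝ) (v : V2) : frameReadInv E hR m s 0 v = v := by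
  refine Lp.ext ((frameReadInv_coeFn E hR m s 0 v).trans (Filter.Eventually.of_forall fun y => ?_))
  simp [hR.X_self m s]

/-- The reading map inverts the inverse reading map (`X m s t ∘ X m t s = id`). -/
theorem frameRead_frameReadInv (E : LagrangianLatticeCarrier k) (hR : E.LevelRegular) (m : ℕ) (s σ : ℝ) (v : V2) :
    frameRead E hR m s σ (frameReadInv E hR m s σ v) = v := by
  set t : ℝ := s + σ / E.a (m + 1) with ht
  have h1 := frameRead_coeFn E hR m s σ (frameReadInv E hR m s σ v)
  have h2 : (fun y => (⇑(frameReadInv E hR m s σ v) : VF) (E.X m t s y)) =ᵐ[volume] fun y => (v : VF) (E.X m s t (E.X m t s y)) :=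
    (hR.measurePreserving_X m t s).quasiMeasurePreserving.ae_eq_comp (frameReadInv_coeFn E hR m s σ v)
  refine Lp.ext ((h1.trans h2).trans (Filter.Eventually.of_forall fun y => ?_))
  have hXX : E.X m s t (E.X m t s y) = y := by
    have h := congrFun (hR.X_comp_X m s t s) y
    rw [Function.comp_apply, hR.X_self m s] at h
    exact h
  simp only [hXX]

/-- The adjoint of the reading map undoes it: `R† (R y) = y` (an isometry). -/
theorem adjoint_frameRead_apply (E : LagrangianLatticeCarrier k) (hR : E.LevelRegular) (m : ℕ) (s σ : ℝ) (y : V2) :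
    ContinuousLinearMap.adjoint (frameRead E hR m s σ) (frameRead E hR m s σ y) = y := by
  refine ext_inner_right ℝ fun z => ?_
  rw [ContinuousLinearMap.adjoint_inner_left, inner_frameRead]

/-- On the whole piece the conjugate family is `frameRead (a(t−s)) ∘ U s t` (the inverse reading at the reset is the identity). -/
theorem conjProp_zero_apply (E : LagrangianLatticeCarrier k) (hR : E.LevelRegular) (m : ℕ) (s t : ℝ) (U : ℝ → ℝ → (V2 →L[ℝ] V2)) (x : V2) :
    conjProp E hR m s U 0 (E.a (m + 1) * (t - s)) x = frameRead E hR m s (E.a (m + 1) * (t - s)) (U s t x) := by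
  have ha : E.a (m + 1) ≠ 0 := (E.a_pos (m + 1)).ne'
  have h1 : s + 0 / E.a (m + 1) = s := by rw [zero_div, add_zero]
  have h2 : s + E.a (m + 1) * (t - s) / E.a (m + 1) = t := by field_simp; ring
  unfold conjProp
  rw [ContinuousLinearMap.comp_apply, ContinuousLinearMap.comp_apply, frameReadInv_zero, h1, h2]

/-! ## §2 (T4) Assembly of `FrameConjugacyAt` -/

/-- **(T4) `FrameConjugacyAt` from a modulation datum for `frameG` and the two distorted propagators.**  See the module docstring. -/
theorem frameConjugacyAt_of {W : LatticeWord k} {M : ℝ} {hM : 0 < M} {c : ℝ} {Φ : ℝ → Torus.Visc4 (Fin 3) → Torus.Visc4 (Fin 3)}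
    {Cα ϱ θ : ℝ} (E : LagrangianLatticeCarrier k) (hR : E.LevelRegular) (m : ℕ) (S : Torus.Visc4 (Fin 3)) {s t : ℝ}
    (hν : 0 < E.cellVisc (m + 1)) (hθ0 : 0 ≤ θ) (hθ : θ ≤ Cα * E.θ (m + 1)) (hϱ : 0 ≤ ϱ)
    (hmod : IsModulation θ (E.a (m + 1) * (t - s)) (ϱ * E.N m) (fun τ y => frameG E m (s + τ / E.a (m + 1)) s y))
    {Um Um1 : ℝ → ℝ → (V2 →L[ℝ] V2)}
    (hUt : IsDistortedPropagator (E.a (m + 1) * (t - s)) ((1 / (E.N (m + 1) : ℝ) ^ 2) • (E.cellVisc (m + 1) • S))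
      (cellField W M hM (E.cellVisc (m + 1)) hν (E.N (m + 1))) (fun τ y => frameG E m (s + τ / E.a (m + 1)) s y) (conjProp E hR m s Um1))
    (hTt : IsDistortedPropagator (E.a (m + 1) * (t - s)) ((1 / (E.N (m + 1) : ℝ) ^ 2) • (E.cellVisc (m + 1) • S +
      (c / E.cellVisc (m + 1)) • Φ (E.cellVisc (m + 1)) ((1 / E.cellVisc (m + 1)) • (E.cellVisc (m + 1) • S)))) (fun _ _ => 0)
      (fun τ y => frameG E m (s + τ / E.a (m + 1)) s y) (conjProp E hR m s Um)) :
    FrameConjugacyAt W M hM c Φ Cα ϱ E m S Um1 Um s t := by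
  refine ⟨⟨hν, by linarith⟩, θ, hθ0, hθ, ϱ * E.N m, by positivity, le_rfl, _, hmod, conjProp E hR m s Um1, conjProp E hR m s Um, hUt, hTt,
    fun x => x, fun y => frameRead E hR m s (E.a (m + 1) * (t - s)) y, ?_, ?_, ?_⟩
  · -- conjugacy
    intro x y _ _
    rw [conjProp_zero_apply, conjProp_zero_apply, ← map_sub, inner_frameRead]
  · -- forward loss
    intro x _
    unfold lossFwd
    rw [conjProp_zero_apply, norm_frameRead]
  · -- adjoint loss
    intro y _
    unfold lossAdj
    have hT : conjProp E hR m s Um 0 (E.a (m + 1) * (t - s)) = (frameRead E hR m s (E.a (m + 1) * (t - s))).comp (Um s t) :=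
      ContinuousLinearMap.ext fun x => by rw [conjProp_zero_apply, ContinuousLinearMap.comp_apply]
    rw [hT, ContinuousLinearMap.adjoint_comp, ContinuousLinearMap.comp_apply, adjoint_frameRead_apply, norm_frameRead]

end Summit.AnomalousDissipation.AnomalousDissipation.Theorems.SolenoidalFractalHomogenisation.LagrangianStep.FrameConj

end
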